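import Summits.AtomisticToContinuum.Crystallization.Theorems.FrustratedLawDichotomyCollarCensusUnion

/-!
# FrustratedLawDichotomy · crux `AperiodicFrustratedLawGap` (stmt-AtomisticToContinuum-27623) — the union-over-steps exemption in SHARP
# (self-priced) form, and its antitonicity in the tolerances `(ε, t)` (decomp-a2c, prover hand 2, generation 18; kernel-facing companion of
# `…CollarCensusUnion`, lens-5 g42 «MoveUnstableSharp: a move priced by its own length»)

`…CollarCensusUnion` exempts a site as soon as `∃ s ∈ [0, S], NonEquilibriumCore eUp ε Rm s t` — a union over a real parameter, awkward for a
certificate kernel that must decide NON-exemption (`∀ s, ¬…`).  Since the dipole allowance `σ(s) = s·(Rm/(Rm − s))⁷·K(Rm)` is nondecreasing on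
`[0, Rm)`, the union of the move tests IS the single SHARP test in which the trial move `p` is priced by its own length `|p − y_j|`
(§1 `exists_step_moveUnstableCore_iff_sharp`, `S < Rm`): `∃ p, |p − y_j| ≤ S ∧ |p − y_j| < 7/10 ∧ E_loc(p) + ε + σ(|p − y_j|) < E_loc(y_j)`; hence
`ExM∪(S) ⟺ sharp-move(S) ∨ RemovalUnstableCore` (`nonEquilibriumCore_union_iff_sharp`).  §2: the exemption only GROWS when the tolerances shrink
(`ε′ ≤ ε`, `t′ ≤ t`: `nonEquilibriumCore_mono_tol`, `…_union_mono_tol`), so the three pieces at `(ε′, t′)` are implied by the pieces at `(ε, t)`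
(`collarPiecesKK_union_of_tol`) — the record `ε = t = 10⁻⁴` certificates transfer to every smaller tolerance, and the E-side hypothesis weakens likewise
(`schurElasticPricingX_locOptFails_anti_eps`).  All `[folklore]`; 0 sorry; no definitions.
-/

noncomputable section

namespace Summit.AtomisticToContinuum.Crystallization.Theorems.FrustratedLawDichotomyCollarCensusUnionSharp

open scoped BigOperators Classical
open Literature.MathematicalPhysics.StatisticalMechanics (lennardJones)
open Summit.AtomisticToContinuum.Crystallization.Theorems.ChargedEnergyGapNegative (E3 eStar)
open Summit.AtomisticToContinuum.Crystallization.Theorems.FrustratedLawDichotomyRangeCut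
open Summit.AtomisticToContinuum.Crystallization.Theorems.FrustratedLawDichotomySchurCut
open Summit.AtomisticToContinuum.Crystallization.Theorems.FrustratedLawDichotomyAveragingCut (ball mem_ball)
open Summit.AtomisticToContinuum.Crystallization.Theorems.FrustratedLawDichotomyExemptDoor (SitePred)
open Summit.AtomisticToContinuum.Crystallization.Theorems.FrustratedLawDichotomyExemptLocOpt (LocOpt LocOptFails)
open Summit.AtomisticToContinuum.Crystallization.Theorems.FrustratedLawDichotomyExemptSplit (SchurElasticPricingX)
open Summit.AtomisticToContinuum.Crystallization.Theorems.FrustratedLawDichotomyExemptLocalSharp (tailConstSharp)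
open Summit.AtomisticToContinuum.Crystallization.Theorems.FrustratedLawDichotomyExemptAbsorption
open Summit.AtomisticToContinuum.Crystallization.Theorems.FrustratedLawDichotomyExemptAbsorptionRecord
open Summit.AtomisticToContinuum.Crystallization.Theorems.FrustratedLawDichotomyCollarCensus
open Summit.AtomisticToContinuum.Crystallization.Theorems.FrustratedLawDichotomyCollarCensusKappa
open Summit.AtomisticToContinuum.Crystallization.Theorems.FrustratedLawDichotomyCollarCensusUnion

/-! ## §1. The dipole allowance is nondecreasing in the step; the union of the move tests is the sharp (self-priced) test -/

/-- The far-field coefficient `K(Rm) = 6000/343·Rm⁻⁴ + 2880/49·Rm⁻⁵ + 10/7·Rm⁻⁶ + 2·Rm⁻⁷` is nonnegative (`Rm ≥ 0`). [folklore] -/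
theorem dipoleCoeff_nonneg {Rm : ℝ} (hRm : 0 ≤ Rm) :
    0 ≤ 6000 / 343 * Rm⁻¹ ^ 4 + 2880 / 49 * Rm⁻¹ ^ 5 + 10 / 7 * Rm⁻¹ ^ 6 + 2 * Rm⁻¹ ^ 7 := by
  have : 0 ≤ Rm⁻¹ := inv_nonneg.2 hRm
  positivity

/-- ★ **The dipole allowance `σ(s) = s·(Rm/(Rm − s))⁷·K(Rm)` is nondecreasing on `[0, Rm)`.** [folklore] -/
theorem dipoleSlack_mono {Rm d s : ℝ} (hd0 : 0 ≤ d) (hds : d ≤ s) (hs : s < Rm) :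
    d * (Rm / (Rm - d)) ^ 7 * (6000 / 343 * Rm⁻¹ ^ 4 + 2880 / 49 * Rm⁻¹ ^ 5 + 10 / 7 * Rm⁻¹ ^ 6 + 2 * Rm⁻¹ ^ 7) ≤
      s * (Rm / (Rm - s)) ^ 7 * (6000 / 343 * Rm⁻¹ ^ 4 + 2880 / 49 * Rm⁻¹ ^ 5 + 10 / 7 * Rm⁻¹ ^ 6 + 2 * Rm⁻¹ ^ 7) := by
  have hRm : 0 ≤ Rm := by linarith
  have hK := dipoleCoeff_nonneg hRm
  have h1 : Rm / (Rm - d) ≤ Rm / (Rm - s) := div_le_div_of_nonneg_left hRm (by linarith) (by linarith)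
  have h2 : 0 ≤ Rm / (Rm - d) := div_nonneg hRm (by linarith)
  have h3 : (Rm / (Rm - d)) ^ 7 ≤ (Rm / (Rm - s)) ^ 7 := pow_le_pow_left₀ h2 h1 7
  exact mul_le_mul_of_nonneg_right (mul_le_mul hds h3 (pow_nonneg h2 7) (hd0.trans hds)) hK

/-- ★★ **THE UNION OF THE MOVE TESTS OVER THE STEPS `s ∈ [0, S]` IS THE SHARP TEST** (`S < Rm`): a trial move priced by its own length.
[folklore] -/
theorem exists_step_moveUnstableCore_iff_sharp {ε Rm S : ℝ} (hS : S < Rm) {N : ℕ} {y : Fin N → E3} {j : Fin N} :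
    (∃ s : ℝ, 0 ≤ s ∧ s ≤ S ∧ MoveUnstableCore ε Rm s N y j) ↔
      ∃ p : E3, dist p (y j) ≤ S ∧ dist p (y j) < 7 / 10 ∧
        (∑ k ∈ (Finset.univ.erase j).filter (fun k => dist (y k) (y j) ≤ Rm), lennardJones (dist p (y k))) +
            (ε + dist p (y j) * (Rm / (Rm - dist p (y j))) ^ 7 *
              (6000 / 343 * Rm⁻¹ ^ 4 + 2880 / 49 * Rm⁻¹ ^ 5 + 10 / 7 * Rm⁻¹ ^ 6 + 2 * Rm⁻¹ ^ 7)) <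
          ∑ k ∈ (Finset.univ.erase j).filter (fun k => dist (y k) (y j) ≤ Rm), lennardJones (dist (y j) (y k)) := by
  constructor
  · rintro ⟨s, hs0, hsS, p, hps, hp7, hlt⟩
    refine ⟨p, hps.trans hsS, hp7, ?_⟩
    have hmono := dipoleSlack_mono (Rm := Rm) dist_nonneg hps (lt_of_le_of_lt hsS hS)
    linarith
  · rintro ⟨p, hpS, hp7, hlt⟩
    exact ⟨dist p (y j), dist_nonneg, hpS, p, le_rfl, hp7, hlt⟩

/-- ★★ **`ExM∪(S) ⟺ sharp-move(S) ∨ removal`** (`0 ≤ S < Rm`): the union-over-steps exemption of `…CollarCensusUnion` as ONE nested flag.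
[folklore] -/
theorem nonEquilibriumCore_union_iff_sharp {eUp ε Rm t S : ℝ} (hS0 : 0 ≤ S) (hS : S < Rm) {N : ℕ} {y : Fin N → E3} {j : Fin N} :
    (∃ s : ℝ, 0 ≤ s ∧ s ≤ S ∧ NonEquilibriumCore eUp ε Rm s t N y j) ↔
      (∃ p : E3, dist p (y j) ≤ S ∧ dist p (y j) < 7 / 10 ∧
        (∑ k ∈ (Finset.univ.erase j).filter (fun k => dist (y k) (y j) ≤ Rm), lennardJones (dist p (y k))) +
            (ε + dist p (y j) * (Rm / (Rm - dist p (y j))) ^ 7 *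
              (6000 / 343 * Rm⁻¹ ^ 4 + 2880 / 49 * Rm⁻¹ ^ 5 + 10 / 7 * Rm⁻¹ ^ 6 + 2 * Rm⁻¹ ^ 7)) <
          ∑ k ∈ (Finset.univ.erase j).filter (fun k => dist (y k) (y j) ≤ Rm), lennardJones (dist (y j) (y k))) ∨
      RemovalUnstableCore eUp t Rm N y j := by
  rw [← exists_step_moveUnstableCore_iff_sharp hS]
  constructor
  · rintro ⟨s, hs0, hsS, hm | hr⟩
    · exact Or.inl ⟨s, hs0, hsS, hm⟩
    · exact Or.inr hr
  · rintro (⟨s, hs0, hsS, hm⟩ | hr)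
    · exact ⟨s, hs0, hsS, Or.inl hm⟩
    · exact ⟨0, le_rfl, hS0, Or.inr hr⟩

/-- ★ **Kernel form of NON-exemption under the union**: a site is NOT `ExM∪(S)`-flagged iff it passes the sharp move test AND the removal test
(`0 ≤ S < Rm`) — what a clean-certificate for the union line has to establish per site. [folklore] -/
theorem not_nonEquilibriumCore_union_iff {eUp ε Rm t S : ℝ} (hS0 : 0 ≤ S) (hS : S < Rm) {N : ℕ} {y : Fin N → E3} {j : Fin N} :
    (¬∃ s : ℝ, 0 ≤ s ∧ s ≤ S ∧ NonEquilibriumCore eUp ε Rm s t N y j) ↔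
      (∀ p : E3, dist p (y j) ≤ S → dist p (y j) < 7 / 10 →
        ∑ k ∈ (Finset.univ.erase j).filter (fun k => dist (y k) (y j) ≤ Rm), lennardJones (dist (y j) (y k)) ≤
          (∑ k ∈ (Finset.univ.erase j).filter (fun k => dist (y k) (y j) ≤ Rm), lennardJones (dist p (y k))) +
            (ε + dist p (y j) * (Rm / (Rm - dist p (y j))) ^ 7 *
              (6000 / 343 * Rm⁻¹ ^ 4 + 2880 / 49 * Rm⁻¹ ^ 5 + 10 / 7 * Rm⁻¹ ^ 6 + 2 * Rm⁻¹ ^ 7))) ∧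
      ¬RemovalUnstableCore eUp t Rm N y j := by
  rw [nonEquilibriumCore_union_iff_sharp hS0 hS, not_or]
  refine and_congr_left fun _ => ?_
  simp only [not_exists, not_and, not_lt]

/-! ## §2. Antitonicity in the tolerances `(ε, t)`: smaller tolerances exempt more and weaken every piece -/

/-- The move test only fires MORE when `ε` shrinks. [folklore] -/
theorem moveUnstableCore_mono_eps {ε ε' Rm s : ℝ} (hε : ε' ≤ ε) {N : ℕ} {y : Fin N → E3} {j : Fin N} (h : MoveUnstableCore ε Rm s N y j) :
    MoveUnstableCore ε' Rm s N y j := by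
  obtain ⟨p, hps, hp7, hlt⟩ := h
  refine ⟨p, hps, hp7, ?_⟩
  nlinarith [hlt, hε]

/-- The removal test only fires MORE when `t` shrinks. [folklore] -/
theorem removalUnstableCore_mono_tol {eUp t t' Rm : ℝ} (ht : t' ≤ t) {N : ℕ} {y : Fin N → E3} {j : Fin N}
    (h : RemovalUnstableCore eUp t Rm N y j) : RemovalUnstableCore eUp t' Rm N y j := by
  unfold RemovalUnstableCore at h ⊢
  linarith

/-- ★ `NonEquilibriumCore eUp ε Rm s t ⊆ NonEquilibriumCore eUp ε′ Rm s t′` for `ε′ ≤ ε`, `t′ ≤ t`. [folklore] -/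
theorem nonEquilibriumCore_mono_tol {eUp ε ε' Rm s t t' : ℝ} (hε : ε' ≤ ε) (ht : t' ≤ t) (N : ℕ) (y : Fin N → E3) (j : Fin N)
    (h : NonEquilibriumCore eUp ε Rm s t N y j) : NonEquilibriumCore eUp ε' Rm s t' N y j :=
  h.imp (moveUnstableCore_mono_eps hε) (removalUnstableCore_mono_tol ht)

/-- ★ The union-over-steps exemption grows when the tolerances shrink. [folklore] -/
theorem nonEquilibriumCore_union_mono_tol {eUp ε ε' Rm t t' S : ℝ} (hε : ε' ≤ ε) (ht : t' ≤ t) (N : ℕ) (y : Fin N → E3) (j : Fin N)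
    (h : ∃ s : ℝ, 0 ≤ s ∧ s ≤ S ∧ NonEquilibriumCore eUp ε Rm s t N y j) :
    ∃ s : ℝ, 0 ≤ s ∧ s ≤ S ∧ NonEquilibriumCore eUp ε' Rm s t' N y j := by
  obtain ⟨s, hs0, hsS, hx⟩ := h
  exact ⟨s, hs0, hsS, nonEquilibriumCore_mono_tol hε ht N y j hx⟩

/-- ★★ **THE THREE UNION PIECES TRANSFER TO SMALLER TOLERANCES** (`ε′ ≤ ε`, `t′ ≤ t`; any levy, geometry, potential data): the record
`(ε, t) = (10⁻⁴, 10⁻⁴)` certificates feed every re-file at smaller tolerances. [folklore] -/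
theorem collarPiecesKK_union_of_tol {κT ρ ϱ D r eUp ε ε' Rm t t' S : ℝ} {W : ℝ → ℝ} {e : ℝ} (hε : ε' ≤ ε) (ht : t' ≤ t)
    (h1 : StrainedPatchMotifPricingCapXK κT ρ ϱ D W e (Collar r fun N y j => ∃ s : ℝ, 0 ≤ s ∧ s ≤ S ∧ NonEquilibriumCore eUp ε Rm s t N y j))
    (h2 : CrowdedCoreMotifPricingCapK κT ρ ϱ D W e (Collar r fun N y j => ∃ s : ℝ, 0 ≤ s ∧ s ≤ S ∧ NonEquilibriumCore eUp ε Rm s t N y j))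
    (h3 : DiluteDefectMotifPricingCapK κT ρ ϱ D W e (Collar r fun N y j => ∃ s : ℝ, 0 ≤ s ∧ s ≤ S ∧ NonEquilibriumCore eUp ε Rm s t N y j)) :
    StrainedPatchMotifPricingCapXK κT ρ ϱ D W e (Collar r fun N y j => ∃ s : ℝ, 0 ≤ s ∧ s ≤ S ∧ NonEquilibriumCore eUp ε' Rm s t' N y j) ∧
      CrowdedCoreMotifPricingCapK κT ρ ϱ D W e (Collar r fun N y j => ∃ s : ℝ, 0 ≤ s ∧ s ≤ S ∧ NonEquilibriumCore eUp ε' Rm s t' N y j) ∧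
      DiluteDefectMotifPricingCapK κT ρ ϱ D W e (Collar r fun N y j => ∃ s : ℝ, 0 ≤ s ∧ s ≤ S ∧ NonEquilibriumCore eUp ε' Rm s t' N y j) :=
  have himp := fun N y j => Collar.mono (nonEquilibriumCore_union_mono_tol (S := S) (Rm := Rm) (eUp := eUp) hε ht) (N := N) (y := y) (j := j)
  ⟨strainedPatchMotifPricingCapXK_anti_exM himp h1, crowdedCoreMotifPricingCapK_anti_exM himp h2, diluteDefectMotifPricingCapK_anti_exM himp h3⟩

/-- `LocOpt` is monotone in the tolerance: `(ε′, ϱ, K)`-optimal ⟹ `(ε, ϱ, K)`-optimal for `ε′ ≤ ε`. [folklore] -/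
theorem locOpt_mono_eps {μ ε ε' ϱ : ℝ} {K : ℕ} (hε : ε' ≤ ε) {N : ℕ} {y : Fin N → E3} {j : Fin N} (h : LocOpt μ ε' ϱ K N y j) :
    LocOpt μ ε ϱ K N y j := fun a s haK hs hsY hsball m R hmK hR hRball hdisj =>
  (h a s haK hs hsY hsball m R hmK hR hRball hdisj).trans (by linarith)

/-- ★ `LocOptFails μ ε ⊆ LocOptFails μ ε′` for `ε′ ≤ ε` (a smaller tolerance exempts more). [folklore] -/
theorem locOptFails_anti_eps {μ ε ε' ϱ : ℝ} {K : ℕ} (hε : ε' ≤ ε) (N : ℕ) (y : Fin N → E3) (j : Fin N) (h : LocOptFails μ ε ϱ K N y j) :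
    LocOptFails μ ε' ϱ K N y j := fun h' => h (locOpt_mono_eps hε h')

/-- ★ **The E-side hypothesis weakens with the tolerance**: `Eopt-raw(κ_E; LocOptFails μ ε ϱ K) ⟹ Eopt-raw(κ_E; LocOptFails μ ε′ ϱ K)` for `ε′ ≤ ε`,
`0 ≤ D_X` (more exempt sites, larger refund). [folklore] -/
theorem schurElasticPricingX_locOptFails_anti_eps {η₀ η₁ : ℝ} {w ω : ℝ → ℝ} {A eUp κE CE DE DX μ ε ε' ϱ : ℝ} {K : ℕ} (hε : ε' ≤ ε)
    (hDX : 0 ≤ DX) (h : SchurElasticPricingX η₀ η₁ w ω A eUp κE CE DE DX (LocOptFails μ ε ϱ K)) :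
    SchurElasticPricingX η₀ η₁ w ω A eUp κE CE DE DX (LocOptFails μ ε' ϱ K) := by
  intro N y hy hsep
  have h1 := h N y hy hsep
  have hcard : (Nat.card {i : Fin N // LocOptFails μ ε ϱ K N y i} : ℝ) ≤ Nat.card {i : Fin N // LocOptFails μ ε' ϱ K N y i} := by
    rw [Nat.card_eq_fintype_card, Nat.card_eq_fintype_card, Fintype.card_subtype, Fintype.card_subtype]
    exact_mod_cast Finset.card_le_card fun i hi => by
      simp only [Finset.mem_filter, Finset.mem_univ, true_and] at hi ⊢
      exact locOptFails_anti_eps hε N y i hi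
  nlinarith [mul_le_mul_of_nonneg_left hcard hDX]

/-! ## §3. The union leaf line with the exemption in sharp (nested-flag) form -/

/-- ★★ **THE UNION LEAF LINE OF `…CollarCensusUnion`, EXEMPTION IN SHARP FORM** (door-free; levies `1/1000`, `1/10000`; record geometry;
`ExM♯∪ = Collar (9/2) (sharp-move(10⁻⁴, Rm = 7, S = 3/2) ∨ RemovalUnstableCore (−0.7175) 10⁻⁴ 7)` — literally the nested flag a certificate kernel
evaluates): `UP(−0.7175) ∧ 0 ≤ D_X ∧ Eopt-raw(1/10000) ∧ F1^X♯∪ ∧ CC♯∪ ∧ DD♯∪ ⟹ AperiodicFrustratedLawGap`. [folklore instantiation] -/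
theorem aperiodicFrustratedLawGap_of_collarPiecesKK_milli_sharp {CE DE DX : ℝ}
    (hU : PeriodicEnergyCeiling (-(7175 / 10000))) (hDX : 0 ≤ DX)
    (hE : SchurElasticPricingX (1 / 20) (1 / 8) w₄₅ ω₄ (3 / 400) (-(7175 / 10000)) (1 / 10000) CE DE DX
      (LocOptFails eStar (1 / 10000) (3 / 2) 1))
    (h1 : StrainedPatchMotifPricingCapXK (1 / 1000) (9 / 5) (133 / 10) (3 / 2) (effPot w₄₅ ω₄ (3 / 400)) (-(7175 / 10000) + 3 / 400)
      (Collar (9 / 2) fun N y j =>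
        (∃ p : E3, dist p (y j) ≤ 3 / 2 ∧ dist p (y j) < 7 / 10 ∧
          (∑ k ∈ (Finset.univ.erase j).filter (fun k => dist (y k) (y j) ≤ 7), lennardJones (dist p (y k))) +
              (1 / 10000 + dist p (y j) * (7 / (7 - dist p (y j))) ^ 7 *
                (6000 / 343 * (7 : ℝ)⁻¹ ^ 4 + 2880 / 49 * (7 : ℝ)⁻¹ ^ 5 + 10 / 7 * (7 : ℝ)⁻¹ ^ 6 + 2 * (7 : ℝ)⁻¹ ^ 7)) <
            ∑ k ∈ (Finset.univ.erase j).filter (fun k => dist (y k) (y j) ≤ 7), lennardJones (dist (y j) (y k))) ∨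
        RemovalUnstableCore (-(7175 / 10000)) (1 / 10000) 7 N y j))
    (h2 : CrowdedCoreMotifPricingCapK (1 / 1000) (9 / 5) (133 / 10) (3 / 2) (effPot w₄₅ ω₄ (3 / 400)) (-(7175 / 10000) + 3 / 400)
      (Collar (9 / 2) fun N y j =>
        (∃ p : E3, dist p (y j) ≤ 3 / 2 ∧ dist p (y j) < 7 / 10 ∧
          (∑ k ∈ (Finset.univ.erase j).filter (fun k => dist (y k) (y j) ≤ 7), lennardJones (dist p (y k))) +
              (1 / 10000 + dist p (y j) * (7 / (7 - dist p (y j))) ^ 7 *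
                (6000 / 343 * (7 : ℝ)⁻¹ ^ 4 + 2880 / 49 * (7 : ℝ)⁻¹ ^ 5 + 10 / 7 * (7 : ℝ)⁻¹ ^ 6 + 2 * (7 : ℝ)⁻¹ ^ 7)) <
            ∑ k ∈ (Finset.univ.erase j).filter (fun k => dist (y k) (y j) ≤ 7), lennardJones (dist (y j) (y k))) ∨
        RemovalUnstableCore (-(7175 / 10000)) (1 / 10000) 7 N y j))
    (h3 : DiluteDefectMotifPricingCapK (1 / 1000) (9 / 5) (133 / 10) (3 / 2) (effPot w₄₅ ω₄ (3 / 400)) (-(7175 / 10000) + 3 / 400)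
      (Collar (9 / 2) fun N y j =>
        (∃ p : E3, dist p (y j) ≤ 3 / 2 ∧ dist p (y j) < 7 / 10 ∧
          (∑ k ∈ (Finset.univ.erase j).filter (fun k => dist (y k) (y j) ≤ 7), lennardJones (dist p (y k))) +
              (1 / 10000 + dist p (y j) * (7 / (7 - dist p (y j))) ^ 7 *
                (6000 / 343 * (7 : ℝ)⁻¹ ^ 4 + 2880 / 49 * (7 : ℝ)⁻¹ ^ 5 + 10 / 7 * (7 : ℝ)⁻¹ ^ 6 + 2 * (7 : ℝ)⁻¹ ^ 7)) <
            ∑ k ∈ (Finset.univ.erase j).filter (fun k => dist (y k) (y j) ≤ 7), lennardJones (dist (y j) (y k))) ∨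
        RemovalUnstableCore (-(7175 / 10000)) (1 / 10000) 7 N y j)) :
    Summit.AtomisticToContinuum.Crystallization.Theses.FrustratedLawDichotomy.AperiodicFrustratedLawGap :=
  have himp : ∀ (N : ℕ) (y : Fin N → E3) (j : Fin N),
      (Collar (9 / 2) fun N y j =>
        (∃ p : E3, dist p (y j) ≤ 3 / 2 ∧ dist p (y j) < 7 / 10 ∧
          (∑ k ∈ (Finset.univ.erase j).filter (fun k => dist (y k) (y j) ≤ 7), lennardJones (dist p (y k))) +
              (1 / 10000 + dist p (y j) * (7 / (7 - dist p (y j))) ^ 7 *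
                (6000 / 343 * (7 : ℝ)⁻¹ ^ 4 + 2880 / 49 * (7 : ℝ)⁻¹ ^ 5 + 10 / 7 * (7 : ℝ)⁻¹ ^ 6 + 2 * (7 : ℝ)⁻¹ ^ 7)) <
            ∑ k ∈ (Finset.univ.erase j).filter (fun k => dist (y k) (y j) ≤ 7), lennardJones (dist (y j) (y k))) ∨
        RemovalUnstableCore (-(7175 / 10000)) (1 / 10000) 7 N y j) N y j →
      (Collar (9 / 2) fun N y j => ∃ s : ℝ, 0 ≤ s ∧ s ≤ 3 / 2 ∧ NonEquilibriumCore (-(7175 / 10000)) (1 / 10000) 7 s (1 / 10000) N y j)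
        N y j :=
    fun N y j => Collar.mono fun N y j h => (nonEquilibriumCore_union_iff_sharp (by norm_num) (by norm_num)).2 h
  aperiodicFrustratedLawGap_of_collarPiecesKK_milli_union_doorFree hU hDX hE (strainedPatchMotifPricingCapXK_anti_exM himp h1)
    (crowdedCoreMotifPricingCapK_anti_exM himp h2) (diluteDefectMotifPricingCapK_anti_exM himp h3)

/-- ★ **Periodic sibling (27624), union leaf line, exemption in sharp form, door-free.** [folklore instantiation] -/
theorem periodicFrustratedLawGap_of_collarPiecesKK_milli_sharp {CE DE DX : ℝ}
    (hU : PeriodicEnergyCeiling (-(7175 / 10000))) (hDX : 0 ≤ DX)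
    (hE : SchurElasticPricingX (1 / 20) (1 / 8) w₄₅ ω₄ (3 / 400) (-(7175 / 10000)) (1 / 10000) CE DE DX
      (LocOptFails eStar (1 / 10000) (3 / 2) 1))
    (h1 : StrainedPatchMotifPricingCapXK (1 / 1000) (9 / 5) (133 / 10) (3 / 2) (effPot w₄₅ ω₄ (3 / 400)) (-(7175 / 10000) + 3 / 400)
      (Collar (9 / 2) fun N y j =>
        (∃ p : E3, dist p (y j) ≤ 3 / 2 ∧ dist p (y j) < 7 / 10 ∧
          (∑ k ∈ (Finset.univ.erase j).filter (fun k => dist (y k) (y j) ≤ 7), lennardJones (dist p (y k))) +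
              (1 / 10000 + dist p (y j) * (7 / (7 - dist p (y j))) ^ 7 *
                (6000 / 343 * (7 : ℝ)⁻¹ ^ 4 + 2880 / 49 * (7 : ℝ)⁻¹ ^ 5 + 10 / 7 * (7 : ℝ)⁻¹ ^ 6 + 2 * (7 : ℝ)⁻¹ ^ 7)) <
            ∑ k ∈ (Finset.univ.erase j).filter (fun k => dist (y k) (y j) ≤ 7), lennardJones (dist (y j) (y k))) ∨
        RemovalUnstableCore (-(7175 / 10000)) (1 / 10000) 7 N y j))
    (h2 : CrowdedCoreMotifPricingCapK (1 / 1000) (9 / 5) (133 / 10) (3 / 2) (effPot w₄₅ ω₄ (3 / 400)) (-(7175 / 10000) + 3 / 400)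
      (Collar (9 / 2) fun N y j =>
        (∃ p : E3, dist p (y j) ≤ 3 / 2 ∧ dist p (y j) < 7 / 10 ∧
          (∑ k ∈ (Finset.univ.erase j).filter (fun k => dist (y k) (y j) ≤ 7), lennardJones (dist p (y k))) +
              (1 / 10000 + dist p (y j) * (7 / (7 - dist p (y j))) ^ 7 *
                (6000 / 343 * (7 : ℝ)⁻¹ ^ 4 + 2880 / 49 * (7 : ℝ)⁻¹ ^ 5 + 10 / 7 * (7 : ℝ)⁻¹ ^ 6 + 2 * (7 : ℝ)⁻¹ ^ 7)) <
            ∑ k ∈ (Finset.univ.erase j).filter (fun k => dist (y k) (y j) ≤ 7), lennardJones (dist (y j) (y k))) ∨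
        RemovalUnstableCore (-(7175 / 10000)) (1 / 10000) 7 N y j))
    (h3 : DiluteDefectMotifPricingCapK (1 / 1000) (9 / 5) (133 / 10) (3 / 2) (effPot w₄₅ ω₄ (3 / 400)) (-(7175 / 10000) + 3 / 400)
      (Collar (9 / 2) fun N y j =>
        (∃ p : E3, dist p (y j) ≤ 3 / 2 ∧ dist p (y j) < 7 / 10 ∧
          (∑ k ∈ (Finset.univ.erase j).filter (fun k => dist (y k) (y j) ≤ 7), lennardJones (dist p (y k))) +
              (1 / 10000 + dist p (y j) * (7 / (7 - dist p (y j))) ^ 7 *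
                (6000 / 343 * (7 : ℝ)⁻¹ ^ 4 + 2880 / 49 * (7 : ℝ)⁻¹ ^ 5 + 10 / 7 * (7 : ℝ)⁻¹ ^ 6 + 2 * (7 : ℝ)⁻¹ ^ 7)) <
            ∑ k ∈ (Finset.univ.erase j).filter (fun k => dist (y k) (y j) ≤ 7), lennardJones (dist (y j) (y k))) ∨
        RemovalUnstableCore (-(7175 / 10000)) (1 / 10000) 7 N y j)) :
    Summit.AtomisticToContinuum.Crystallization.Theses.FrustratedLawDichotomy.PeriodicFrustratedLawGap :=
  have himp : ∀ (N : ℕ) (y : Fin N → E3) (j : Fin N),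
      (Collar (9 / 2) fun N y j =>
        (∃ p : E3, dist p (y j) ≤ 3 / 2 ∧ dist p (y j) < 7 / 10 ∧
          (∑ k ∈ (Finset.univ.erase j).filter (fun k => dist (y k) (y j) ≤ 7), lennardJones (dist p (y k))) +
              (1 / 10000 + dist p (y j) * (7 / (7 - dist p (y j))) ^ 7 *
                (6000 / 343 * (7 : ℝ)⁻¹ ^ 4 + 2880 / 49 * (7 : ℝ)⁻¹ ^ 5 + 10 / 7 * (7 : ℝ)⁻¹ ^ 6 + 2 * (7 : ℝ)⁻¹ ^ 7)) <
            ∑ k ∈ (Finset.univ.erase j).filter (fun k => dist (y k) (y j) ≤ 7), lennardJones (dist (y j) (y k))) ∨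
        RemovalUnstableCore (-(7175 / 10000)) (1 / 10000) 7 N y j) N y j →
      (Collar (9 / 2) fun N y j => ∃ s : ℝ, 0 ≤ s ∧ s ≤ 3 / 2 ∧ NonEquilibriumCore (-(7175 / 10000)) (1 / 10000) 7 s (1 / 10000) N y j)
        N y j :=
    fun N y j => Collar.mono fun N y j h => (nonEquilibriumCore_union_iff_sharp (by norm_num) (by norm_num)).2 h
  periodicFrustratedLawGap_of_collarPiecesKK_milli_union_doorFree hU hDX hE (strainedPatchMotifPricingCapXK_anti_exM himp h1)
    (crowdedCoreMotifPricingCapK_anti_exM himp h2) (diluteDefectMotifPricingCapK_anti_exM himp h3)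

/-! ## §4. The two remaining dials as parameters of the union line: the RANGE data and the BALL RADIUS (appended, hand 2 g18;
critic row 641: F1X♭q SUSPECT under joint interior+annulus dressing — the structural levers are the W-range (Schur slack `1.15·10⁻³` at
`9/2` vs `2.8·10⁻⁴` at `6`, `…SchurCut` table) and the ball radius `ρ`; both re-files are instantiations of the theorems below) -/

open Summit.AtomisticToContinuum.Crystallization.Theorems.FrustratedLawDichotomyAveragingCut (CutBounds)
open Summit.AtomisticToContinuum.Crystallization.Theorems.FrustratedLawDichotomyExemptLocOpt (deepAbsent_locOptFails)
open Summit.AtomisticToContinuum.Crystallization.Theorems.GrainCoreNetworkSplitMuEquilibriumDoor (muEquilibriumDoor)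

/-- ★★ **THE UNION NODE, GENERIC IN THE RANGE DATA** (`SchurFloor w ω A`, `CutBounds (effPot w ω A) R B`, `effPot w ω A = 0` on `[R′, ∞)`,
`UP(eUp)`; both levies; geometry with `R′ ≤ ρ₁ + r`, `Rm ≤ ρ₁`, `1 + S ≤ Rm`, `S ≤ ϱ′`, `ε ≤ t`): the apex `…CollarCensusUnion.…_exM` at the
union-over-steps exemption.  A range-`R′` re-file of the line of record = this theorem applied to `(w_R′, ω_R′, A_R′)` data. [folklore chaining] -/
theorem aperiodicFrustratedLawGap_of_collarMotifCapKK_union_generic {w ω : ℝ → ℝ}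
    {A R B R' eUp κT κE ρ r ρ₁ ϱ D ε Rm t S ϱ' CE DE DX : ℝ}
    (hDoor : Summit.AtomisticToContinuum.Crystallization.Theses.GrainCoreNetworkSplit.MuEquilibriumDoor)
    (hF : SchurFloor w ω A) (hWB : CutBounds (effPot w ω A) R B) (hW : ∀ u, R' ≤ u → effPot w ω A u = 0)
    (hU : PeriodicEnergyCeiling eUp) (hε : 0 < ε) (hDX : 0 ≤ DX) (hκE : 0 < κE)
    (hE : SchurElasticPricingX (1 / 20) (1 / 8) w ω A eUp κE CE DE DX (LocOptFails eStar ε ϱ' 1))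
    (hκ0 : 0 < κT) (hκ1 : κT ≤ 1) (h0 : 0 ≤ ρ) (hr : 0 ≤ r) (h1 : 0 ≤ ρ₁) (hρ : ρ ≤ ρ₁ + r) (hR : R' ≤ ρ₁ + r)
    (hD : 13 / 10 * D + 1 ≤ ρ₁ + r) (hRm : Rm ≤ ρ₁) (hϱ : ρ + (ρ₁ + r) ≤ ϱ) (hRm1 : 1 + S ≤ Rm) (hS : S ≤ ϱ') (hεt : ε ≤ t)
    (h : EquilibriumMotifPricingCapK κT ρ ϱ D (effPot w ω A) (eUp + A) (Collar r fun N y j => ∃ s : ℝ, 0 ≤ s ∧ s ≤ S ∧ NonEquilibriumCore eUp ε Rm s t N y j)) :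
    Summit.AtomisticToContinuum.Crystallization.Theses.FrustratedLawDichotomy.AperiodicFrustratedLawGap :=
  aperiodicFrustratedLawGap_of_collarMotifCapKK_exM hDoor hF hWB hW hU (deepAbsent_locOptFails hε) hDX hκE hE hκ0 hκ1 h0 hr h1 hρ hR hD hϱ
    (flag_nonEquilibriumCore_union_isLocal hRm)
    (fun _ _ _ hsep _ hx => locOptFails_of_nonEquilibriumCore_union (eStar_le_of_periodicEnergyCeiling hU) hRm1 hS hεt hsep hx) h

/-- ★ **Periodic sibling (27624) of the range-generic union node.** [folklore chaining] -/
theorem periodicFrustratedLawGap_of_collarMotifCapKK_union_generic {w ω : ℝ → ℝ}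
    {A R B R' eUp κT κE ρ r ρ₁ ϱ D ε Rm t S ϱ' CE DE DX : ℝ}
    (hDoor : Summit.AtomisticToContinuum.Crystallization.Theses.GrainCoreNetworkSplit.MuEquilibriumDoor)
    (hF : SchurFloor w ω A) (hWB : CutBounds (effPot w ω A) R B) (hW : ∀ u, R' ≤ u → effPot w ω A u = 0)
    (hU : PeriodicEnergyCeiling eUp) (hε : 0 < ε) (hDX : 0 ≤ DX) (hκE : 0 < κE)
    (hE : SchurElasticPricingX (1 / 20) (1 / 8) w ω A eUp κE CE DE DX (LocOptFails eStar ε ϱ' 1))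
    (hκ0 : 0 < κT) (hκ1 : κT ≤ 1) (h0 : 0 ≤ ρ) (hr : 0 ≤ r) (h1 : 0 ≤ ρ₁) (hρ : ρ ≤ ρ₁ + r) (hR : R' ≤ ρ₁ + r)
    (hD : 13 / 10 * D + 1 ≤ ρ₁ + r) (hRm : Rm ≤ ρ₁) (hϱ : ρ + (ρ₁ + r) ≤ ϱ) (hRm1 : 1 + S ≤ Rm) (hS : S ≤ ϱ') (hεt : ε ≤ t)
    (h : EquilibriumMotifPricingCapK κT ρ ϱ D (effPot w ω A) (eUp + A) (Collar r fun N y j => ∃ s : ℝ, 0 ≤ s ∧ s ≤ S ∧ NonEquilibriumCore eUp ε Rm s t N y j)) :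
    Summit.AtomisticToContinuum.Crystallization.Theses.FrustratedLawDichotomy.PeriodicFrustratedLawGap :=
  periodicFrustratedLawGap_of_collarMotifCapKK_exM hDoor hF hWB hW hU (deepAbsent_locOptFails hε) hDX hκE hE hκ0 hκ1 h0 hr h1 hρ hR hD hϱ
    (flag_nonEquilibriumCore_union_isLocal hRm)
    (fun _ _ _ hsep _ hx => locOptFails_of_nonEquilibriumCore_union (eStar_le_of_periodicEnergyCeiling hU) hRm1 hS hεt hsep hx) h

/-- ★★ **THE UNION LEAF LINE WITH THE BALL RADIUS `ρ` AS A PARAMETER** (door-free; record range data, levies, collar, steps; motif radius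
`ϱ = ρ + 23/2`, `0 ≤ ρ ≤ 23/2 = ρ₁ + r`; beyond that raise the collar/locality radii in `…_union_generic`): `UP(−0.7175) ∧ 0 ≤ D_X ∧ Eopt-raw(1/10000) ∧ F1^X∪(ρ) ∧ CC∪(ρ) ∧ DD∪(ρ) ⟹ AperiodicFrustratedLawGap` — the line of record
is `ρ = 9/5`; a larger ball averages a strained patch together with more of its surroundings (lens-5 g42 dial table (d)). [folklore instantiation] -/
theorem aperiodicFrustratedLawGap_of_collarPiecesKK_milli_union_ball {ρ CE DE DX : ℝ} (h0 : 0 ≤ ρ) (hρ : ρ ≤ 23 / 2)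
    (hU : PeriodicEnergyCeiling (-(7175 / 10000))) (hDX : 0 ≤ DX)
    (hE : SchurElasticPricingX (1 / 20) (1 / 8) w₄₅ ω₄ (3 / 400) (-(7175 / 10000)) (1 / 10000) CE DE DX
      (LocOptFails eStar (1 / 10000) (3 / 2) 1))
    (h1 : StrainedPatchMotifPricingCapXK (1 / 1000) ρ (ρ + 23 / 2) (3 / 2) (effPot w₄₅ ω₄ (3 / 400)) (-(7175 / 10000) + 3 / 400)
      (Collar (9 / 2) fun N y j => ∃ s : ℝ, 0 ≤ s ∧ s ≤ 3 / 2 ∧ NonEquilibriumCore (-(7175 / 10000)) (1 / 10000) 7 s (1 / 10000) N y j))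
    (h2 : CrowdedCoreMotifPricingCapK (1 / 1000) ρ (ρ + 23 / 2) (3 / 2) (effPot w₄₅ ω₄ (3 / 400)) (-(7175 / 10000) + 3 / 400)
      (Collar (9 / 2) fun N y j => ∃ s : ℝ, 0 ≤ s ∧ s ≤ 3 / 2 ∧ NonEquilibriumCore (-(7175 / 10000)) (1 / 10000) 7 s (1 / 10000) N y j))
    (h3 : DiluteDefectMotifPricingCapK (1 / 1000) ρ (ρ + 23 / 2) (3 / 2) (effPot w₄₅ ω₄ (3 / 400)) (-(7175 / 10000) + 3 / 400)
      (Collar (9 / 2) fun N y j => ∃ s : ℝ, 0 ≤ s ∧ s ≤ 3 / 2 ∧ NonEquilibriumCore (-(7175 / 10000)) (1 / 10000) 7 s (1 / 10000) N y j)) :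
    Summit.AtomisticToContinuum.Crystallization.Theses.FrustratedLawDichotomy.AperiodicFrustratedLawGap :=
  aperiodicFrustratedLawGap_of_collarMotifCapKK_union (ρ₁ := 7) (r := 9 / 2) muEquilibriumDoor hU (by norm_num) hDX (by norm_num) hE
    (by norm_num) (by norm_num) h0 (by norm_num) (by norm_num) (by linarith) (by norm_num) (by norm_num) le_rfl (by linarith) (by norm_num)
    le_rfl le_rfl (equilibriumMotifPricingCapK_iff_pieces.2 ⟨h1, h2, h3⟩)

/-- ★ **Periodic sibling (27624), ball radius as a parameter, door-free.** [folklore instantiation] -/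
theorem periodicFrustratedLawGap_of_collarPiecesKK_milli_union_ball {ρ CE DE DX : ℝ} (h0 : 0 ≤ ρ) (hρ : ρ ≤ 23 / 2)
    (hU : PeriodicEnergyCeiling (-(7175 / 10000))) (hDX : 0 ≤ DX)
    (hE : SchurElasticPricingX (1 / 20) (1 / 8) w₄₅ ω₄ (3 / 400) (-(7175 / 10000)) (1 / 10000) CE DE DX
      (LocOptFails eStar (1 / 10000) (3 / 2) 1))
    (h1 : StrainedPatchMotifPricingCapXK (1 / 1000) ρ (ρ + 23 / 2) (3 / 2) (effPot w₄₅ ω₄ (3 / 400)) (-(7175 / 10000) + 3 / 400)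
      (Collar (9 / 2) fun N y j => ∃ s : ℝ, 0 ≤ s ∧ s ≤ 3 / 2 ∧ NonEquilibriumCore (-(7175 / 10000)) (1 / 10000) 7 s (1 / 10000) N y j))
    (h2 : CrowdedCoreMotifPricingCapK (1 / 1000) ρ (ρ + 23 / 2) (3 / 2) (effPot w₄₅ ω₄ (3 / 400)) (-(7175 / 10000) + 3 / 400)
      (Collar (9 / 2) fun N y j => ∃ s : ℝ, 0 ≤ s ∧ s ≤ 3 / 2 ∧ NonEquilibriumCore (-(7175 / 10000)) (1 / 10000) 7 s (1 / 10000) N y j))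
    (h3 : DiluteDefectMotifPricingCapK (1 / 1000) ρ (ρ + 23 / 2) (3 / 2) (effPot w₄₅ ω₄ (3 / 400)) (-(7175 / 10000) + 3 / 400)
      (Collar (9 / 2) fun N y j => ∃ s : ℝ, 0 ≤ s ∧ s ≤ 3 / 2 ∧ NonEquilibriumCore (-(7175 / 10000)) (1 / 10000) 7 s (1 / 10000) N y j)) :
    Summit.AtomisticToContinuum.Crystallization.Theses.FrustratedLawDichotomy.PeriodicFrustratedLawGap :=
  periodicFrustratedLawGap_of_collarMotifCapKK_union (ρ₁ := 7) (r := 9 / 2) muEquilibriumDoor hU (by norm_num) hDX (by norm_num) hE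
    (by norm_num) (by norm_num) h0 (by norm_num) (by norm_num) (by linarith) (by norm_num) (by norm_num) le_rfl (by linarith) (by norm_num)
    le_rfl le_rfl (equilibriumMotifPricingCapK_iff_pieces.2 ⟨h1, h2, h3⟩)

/-- Sanity: at `ρ = 9/5` the ball-parametric leaf IS the line of record `…CollarCensusUnion.…_milli_union_doorFree` (`9/5 + 23/2 = 133/10`;
an `example`, dedup). [folklore] -/
example {CE DE DX : ℝ} (hU : PeriodicEnergyCeiling (-(7175 / 10000))) (hDX : 0 ≤ DX)
    (hE : SchurElasticPricingX (1 / 20) (1 / 8) w₄₅ ω₄ (3 / 400) (-(7175 / 10000)) (1 / 10000) CE DE DX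
      (LocOptFails eStar (1 / 10000) (3 / 2) 1))
    (h1 : StrainedPatchMotifPricingCapXK (1 / 1000) (9 / 5) (133 / 10) (3 / 2) (effPot w₄₅ ω₄ (3 / 400)) (-(7175 / 10000) + 3 / 400)
      (Collar (9 / 2) fun N y j => ∃ s : ℝ, 0 ≤ s ∧ s ≤ 3 / 2 ∧ NonEquilibriumCore (-(7175 / 10000)) (1 / 10000) 7 s (1 / 10000) N y j))
    (h2 : CrowdedCoreMotifPricingCapK (1 / 1000) (9 / 5) (133 / 10) (3 / 2) (effPot w₄₅ ω₄ (3 / 400)) (-(7175 / 10000) + 3 / 400)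
      (Collar (9 / 2) fun N y j => ∃ s : ℝ, 0 ≤ s ∧ s ≤ 3 / 2 ∧ NonEquilibriumCore (-(7175 / 10000)) (1 / 10000) 7 s (1 / 10000) N y j))
    (h3 : DiluteDefectMotifPricingCapK (1 / 1000) (9 / 5) (133 / 10) (3 / 2) (effPot w₄₅ ω₄ (3 / 400)) (-(7175 / 10000) + 3 / 400)
      (Collar (9 / 2) fun N y j => ∃ s : ℝ, 0 ≤ s ∧ s ≤ 3 / 2 ∧ NonEquilibriumCore (-(7175 / 10000)) (1 / 10000) 7 s (1 / 10000) N y j)) :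
    Summit.AtomisticToContinuum.Crystallization.Theses.FrustratedLawDichotomy.AperiodicFrustratedLawGap := by
  have e : (9 / 5 : ℝ) + 23 / 2 = 133 / 10 := by norm_num
  exact aperiodicFrustratedLawGap_of_collarPiecesKK_milli_union_ball (by norm_num) (by norm_num) hU hDX hE (e ▸ h1) (e ▸ h2) (e ▸ h3)

/-! ## §5. The kernel socket for CLEAN certificates under the union line: a length-dependent threshold (appended, hand 2 g18) -/

/-- ★★ **UNION-CLEAN FROM ANY LOWER BOUND `θ(p) ≤ |p − y_j|` ON THE MOVE LENGTH** (`0 ≤ S < Rm`): if every trial move `p` in the `7/10`-ball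
(`|p − y_j| ≤ S`) satisfies `E_loc(y_j) ≤ E_loc(p) + ε + σ(θ(p))` for some `0 ≤ θ(p) ≤ |p − y_j|` (e.g. `θ` = the inner radius of the certificate
zone containing `p` — a zoned `checkMove` with per-zone thresholds `ε + σ(s_{k−1})`), and the removal test fails, then the site is NOT exempt under the
union-over-steps flag `ExM∪(S)` (`dipoleSlack_mono`) — the per-site obligation of a must-price (clean) certificate for the line of record. [folklore] -/
theorem not_nonEquilibriumCore_union_of_bound {eUp ε Rm t S : ℝ} (hS0 : 0 ≤ S) (hS : S < Rm) {N : ℕ} {y : Fin N → E3} {j : Fin N}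
    (θ : E3 → ℝ) (hθ : ∀ p : E3, dist p (y j) ≤ S → dist p (y j) < 7 / 10 → 0 ≤ θ p ∧ θ p ≤ dist p (y j))
    (hgain : ∀ p : E3, dist p (y j) ≤ S → dist p (y j) < 7 / 10 →
      ∑ k ∈ (Finset.univ.erase j).filter (fun k => dist (y k) (y j) ≤ Rm), lennardJones (dist (y j) (y k)) ≤
        (∑ k ∈ (Finset.univ.erase j).filter (fun k => dist (y k) (y j) ≤ Rm), lennardJones (dist p (y k))) +
          (ε + θ p * (Rm / (Rm - θ p)) ^ 7 * (6000 / 343 * Rm⁻¹ ^ 4 + 2880 / 49 * Rm⁻¹ ^ 5 + 10 / 7 * Rm⁻¹ ^ 6 + 2 * Rm⁻¹ ^ 7)))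
    (hrem : ¬RemovalUnstableCore eUp t Rm N y j) :
    ¬∃ s : ℝ, 0 ≤ s ∧ s ≤ S ∧ NonEquilibriumCore eUp ε Rm s t N y j := by
  rw [not_nonEquilibriumCore_union_iff hS0 hS]
  refine ⟨fun p hpS hp7 => ?_, hrem⟩
  obtain ⟨h0, hle⟩ := hθ p hpS hp7
  have hmono := dipoleSlack_mono (Rm := Rm) h0 hle (lt_of_le_of_lt hpS hS)
  linarith [hgain p hpS hp7]

/-- ★ **Two-zone instance** (`0 ≤ s₀ ≤ S < Rm`): threshold `ε` on the inner ball `|p − y_j| ≤ s₀`, `ε + σ(s₀)` on the shell `s₀ ≤ |p − y_j| ≤ S`,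
plus the removal test ⟹ union-clean (the shape of `…CollarNonExemptZones.not_moveUnstableCore_of_twoZone`, sharp thresholds). [folklore] -/
theorem not_nonEquilibriumCore_union_of_twoZone {eUp ε Rm t S s₀ : ℝ} (hs₀ : 0 ≤ s₀) (hs₀S : s₀ ≤ S) (hS : S < Rm) {N : ℕ}
    {y : Fin N → E3} {j : Fin N}
    (hball : ∀ p : E3, dist p (y j) ≤ s₀ → dist p (y j) < 7 / 10 →
      ∑ k ∈ (Finset.univ.erase j).filter (fun k => dist (y k) (y j) ≤ Rm), lennardJones (dist (y j) (y k)) ≤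
        (∑ k ∈ (Finset.univ.erase j).filter (fun k => dist (y k) (y j) ≤ Rm), lennardJones (dist p (y k))) + ε)
    (hshell : ∀ p : E3, s₀ ≤ dist p (y j) → dist p (y j) ≤ S → dist p (y j) < 7 / 10 →
      ∑ k ∈ (Finset.univ.erase j).filter (fun k => dist (y k) (y j) ≤ Rm), lennardJones (dist (y j) (y k)) ≤
        (∑ k ∈ (Finset.univ.erase j).filter (fun k => dist (y k) (y j) ≤ Rm), lennardJones (dist p (y k))) +
          (ε + s₀ * (Rm / (Rm - s₀)) ^ 7 * (6000 / 343 * Rm⁻¹ ^ 4 + 2880 / 49 * Rm⁻¹ ^ 5 + 10 / 7 * Rm⁻¹ ^ 6 + 2 * Rm⁻¹ ^ 7)))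
    (hrem : ¬RemovalUnstableCore eUp t Rm N y j) :
    ¬∃ s : ℝ, 0 ≤ s ∧ s ≤ S ∧ NonEquilibriumCore eUp ε Rm s t N y j := by
  classical
  refine not_nonEquilibriumCore_union_of_bound (hs₀.trans hs₀S) hS (fun p => if dist p (y j) ≤ s₀ then 0 else s₀)
    (fun p _ _ => ?_) (fun p hpS hp7 => ?_) hrem
  · split_ifs with h
    · exact ⟨le_rfl, dist_nonneg⟩
    · exact ⟨hs₀, (not_le.mp h).le⟩
  · split_ifs with h
    · have h1 := hball p h hp7
      simp only [zero_mul]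
      linarith
    · exact hshell p (not_le.mp h).le hpS hp7

end Summit.AtomisticToContinuum.Crystallization.Theorems.FrustratedLawDichotomyCollarCensusUnionSharp

end
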